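/-
HONEST FRAMING: certified error envelopes and provably optimal rounding/accumulation schemes for
low-precision formats under stated cost models; every table by two implementations; no hardware
or vendor claims.
-/
import Summits.Ventures.CertifiedArithmetic.LowPrec.OptDemotionRouting

/-!
# The demotion law (Theorem T8), part 8b: DELETING BIT FAMILIES (opt gen 13, R17(b) "deletion")

For the weighted routing value `treeBRw q W t S` of part 8a: a bit family is a residue class of
exponents mod `q` (an original bit `e` and its iterated injections `e - q, e - 2q, …`); more
generally any set `p` of exponents with `p (e - q) ↔ p e`.
* `treeBRw_null` — a configuration all of whose families carry weight `0` scores `0`;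
* `treeBRw_le_filter` — THE DELETION LEMMA: if `W ≥ 0` vanishes off `p`, deleting the bits
  outside `p` from a routable configuration never decreases the value
  (`treeBRw q W t S ≤ treeBRw q W t (S.filter p)`): the restricted routing is still valid, and a
  node whose top bit is deleted re-scores with a bit of nonnegative weight.
Part 8c uses it with `p` = "the classes of the leading bit and of one other bit".
-/

namespace Summit.Ventures.CertifiedArithmetic.LowPrec.Opt

open Literature.ComputerArithmetic.JeannerodRump2018
open Literature.ComputerArithmetic.JeannerodRump2018.SumTree

/-- NULL FAMILIES SCORE NOTHING: `W = 0` on a set of exponents closed under `e ↦ e - q` and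
containing `S`. -/
theorem treeBRw_null {q : ℕ} {W : ℤ → ℚ} {p : ℤ → Prop} (hp : ∀ e, p e → p (e - q))
    (hW : ∀ e, p e → W e = 0) (t : SumTree) (S : Finset ℤ) (hS : ∀ e ∈ S, p e) :
    treeBRw q W t S = 0 := by
  rw [treeBRw_congr (W' := fun _ => 0) hp hW t S hS, treeBRw_zero]

/-- Filtering a set difference. -/
theorem filter_sdiff_eq {p : ℤ → Prop} [DecidablePred p] (T A : Finset ℤ) :
    (T \ A).filter p = T.filter p \ A.filter p := by
  ext x
  simp only [Finset.mem_filter, Finset.mem_sdiff]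
  tauto

/-- A valid split restricts to a valid split of the filtered configuration (top bit kept). -/
theorem filter_mem_splits_of_pos {q : ℕ} {p : ℤ → Prop} [DecidablePred p] (hp : ∀ e, p (e - q) ↔ p e)
    {S : Finset ℤ} {e₀ : ℤ} (he₀ : p e₀) {A B : Finset ℤ} (h : (A, B) ∈ splits q S e₀) :
    (A.filter p, B.filter p) ∈ splits q (S.filter p) e₀ := by
  obtain ⟨h1, hA, hB⟩ := mem_splits.1 h
  refine mem_splits.2 ⟨?_, hA.mono (Finset.filter_subset _ _), hB.mono (Finset.filter_subset _ _)⟩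
  rcases h1 with ⟨hs, hB'⟩ | ⟨hs, hB'⟩ <;> simp only at hs hB'
  · exact Or.inl ⟨Finset.filter_subset_filter p hs, by rw [hB', filter_sdiff_eq]⟩
  · right
    have hι : p (e₀ - q) := (hp e₀).2 he₀
    have e1 : (insert (e₀ - (q : ℤ)) S).filter p = insert (e₀ - (q : ℤ)) (S.filter p) := by
      rw [Finset.filter_insert, if_pos hι]
    refine ⟨?_, ?_⟩
    · rw [← e1]; exact Finset.filter_subset_filter p hs
    · rw [hB', filter_sdiff_eq, e1]

/-- A valid split restricts to a valid split of the filtered configuration (top bit deleted). -/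
theorem filter_mem_splits_of_neg {q : ℕ} {p : ℤ → Prop} [DecidablePred p] (hp : ∀ e, p (e - q) ↔ p e)
    {S : Finset ℤ} {e₀ : ℤ} (he₀ : ¬ p e₀) {A B : Finset ℤ} (h : (A, B) ∈ splits q S e₀) (e₁ : ℤ) :
    (A.filter p, B.filter p) ∈ splits q (S.filter p) e₁ := by
  obtain ⟨h1, hA, hB⟩ := mem_splits.1 h
  refine mem_splits.2 ⟨Or.inl ?_, hA.mono (Finset.filter_subset _ _), hB.mono (Finset.filter_subset _ _)⟩
  rcases h1 with ⟨hs, hB'⟩ | ⟨hs, hB'⟩ <;> simp only at hs hB'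
  · exact ⟨Finset.filter_subset_filter p hs, by rw [hB', filter_sdiff_eq]⟩
  · have hι : ¬ p (e₀ - q) := fun h => he₀ ((hp e₀).1 h)
    have e1 : (insert (e₀ - (q : ℤ)) S).filter p = S.filter p := by
      rw [Finset.filter_insert, if_neg hι]
    refine ⟨?_, ?_⟩
    · rw [← e1]; exact Finset.filter_subset_filter p hs
    · rw [hB', filter_sdiff_eq, e1]

/-- THE DELETION LEMMA (R17(b)): `W ≥ 0` vanishing off a set `p` of exponents with
`p (e - q) ↔ p e`; then deleting the bits outside `p` never decreases the routing value of a
routable configuration. -/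
theorem treeBRw_le_filter {q : ℕ} {W : ℤ → ℚ} (hW0 : ∀ e, 0 ≤ W e) {p : ℤ → Prop} [DecidablePred p]
    (hp : ∀ e, p (e - q) ↔ p e) (hW : ∀ e, ¬ p e → W e = 0) :
    ∀ (t : SumTree) (S : Finset ℤ), Routable q S → treeBRw q W t S ≤ treeBRw q W t (S.filter p)
  | .leaf _, S, _ => by simp
  | .node a b, S, hS => by
      by_cases h : S.Nonempty
      · by_cases h' : (S.filter p).Nonempty
        · -- the top bit of the filtered configuration
          have htop' : W (S.max' h) ≤ W ((S.filter p).max' h') := by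
            by_cases hpt : p (S.max' h)
            · have hle : S.max' h ≤ (S.filter p).max' h' :=
                Finset.le_max' _ _ (Finset.mem_filter.2 ⟨Finset.max'_mem S h, hpt⟩)
              have hge : (S.filter p).max' h' ≤ S.max' h :=
                Finset.le_max' _ _ (Finset.filter_subset _ _ (Finset.max'_mem _ h'))
              rw [le_antisymm hle hge]
            · rw [hW _ hpt]; exact hW0 _
          have hfold0 := fold_max_nonneg (splits q (S.filter p) ((S.filter p).max' h'))
            (fun AB => treeBRw q W a AB.1 + treeBRw q W b AB.2)
          rcases treeBRw_node_eq (q := q) (W := W) (a := a) (b := b) h with h0 | ⟨AB, hAB, hval⟩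
          · rw [h0, treeBRw_node q W a b h']
            linarith
          · rw [hval]
            obtain ⟨-, -, -, -, hrA, hrB⟩ := of_mem_splits (A := AB.1) (B := AB.2) hAB
            have iha := treeBRw_le_filter hW0 hp hW a AB.1 hrA
            have ihb := treeBRw_le_filter hW0 hp hW b AB.2 hrB
            -- the restricted split is valid for the filtered configuration
            have hmem : (AB.1.filter p, AB.2.filter p) ∈ splits q (S.filter p) ((S.filter p).max' h') := by
              by_cases hpt : p (S.max' h)
              · have heq : (S.filter p).max' h' = S.max' h :=
                  le_antisymm (Finset.le_max' _ _ (Finset.filter_subset _ _ (Finset.max'_mem _ h')))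
                    (Finset.le_max' _ _ (Finset.mem_filter.2 ⟨Finset.max'_mem S h, hpt⟩))
                rw [heq]; exact filter_mem_splits_of_pos hp hpt hAB
              · exact filter_mem_splits_of_neg hp hpt hAB _
            have hs := split_le_treeBRw_node (q := q) (W := W) (a := a) (b := b) h' hmem
            linarith
        · -- everything is deleted: all of `S` is null, so the value is `0`
          rw [Finset.not_nonempty_iff_eq_empty.1 h', treeBRw_empty]
          have hnull : ∀ e ∈ S, ¬ p e := fun e he hpe =>
            h' ⟨e, Finset.mem_filter.2 ⟨he, hpe⟩⟩
          rw [treeBRw_null (p := fun e => ¬ p e) (fun e hne hpe => hne ((hp e).1 hpe)) hW _ S hnull]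
      · rw [Finset.not_nonempty_iff_eq_empty.1 h, Finset.filter_empty, treeBRw_empty]

end Summit.Ventures.CertifiedArithmetic.LowPrec.Opt
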